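import Literature.Analysis.FluidPDE.Axisymmetric
import HarnessLib

/-!
# KNSS 2009, §6: no axisymmetric Type I blow-up — Theorems 6.1–6.2 as named facts and the
# assembly of `knss_no_axisymmetric_typeI` from its parts

Analysis/FluidPDE facts file on the decomposition path of the named fact
`Literature.Analysis.FluidPDE.knss_no_axisymmetric_typeI` (`Axisymmetric.lean`; **ns.S24**, second
clause). That fact bundles two alternatives for an axisymmetric classical solution `(u, p)` of
Navier–Stokes on `ℝ³ × [0, T)` which is Leray–Hopf on `[0, T)` and bounded on `ℝ³ × [0, T']` for
every `T' < T`: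

* alternative 2, `r ‖u‖ ≤ C` on `[0, T) × ℝ³` — this is Koch–Nadirashvili–Seregin–Šverák, Acta
  Math. 203 (2009) = arXiv:0709.3599, **Theorem 6.1** verbatim (a classical solution bounded on
  the sub-slabs is a bounded weak solution there in the sense of KNSS §4 (ii), by integration by
  parts), followed by the continuation of bounded classical Leray–Hopf solutions;
* alternative 1, the Type I rate `‖u(t, x)‖ ≤ C/√(T − t)` near `T` (`IsTypeIBlowup u T`) with
  finite energy but **no** spatial decay — this is NOT KNSS **Theorem 6.2**, which assumes in
  addition `‖u‖ ≤ C/|x'|` for `|x'| ≥ R₀` (its (assumption2); "the statement fails, for trivial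
  reasons, if we drop (assumption2) (consider `u(x,t) = b(t)`)", arXiv p. 12 — finite energy
  excludes `b(t)` but gives no pointwise decay); as the docstring of the fact says, it is the
  global consequence, for finite-energy classical solutions, of the LOCAL theorem of
  Seregin–Šverák (Comm. PDE 34 (2009), Thm. 3.1 = Thm. 1.1; catalogued as the barrier fact
  `Literature.Barriers.NavierStokesRegularity.AxisymmetricTypeIExclusion`) combined with the
  Caffarelli–Kohn–Nirenberg ε-regularity theory (regularity off the axis and near spatial
  infinity) and a covering argument.

This file vendors, over the tree's classical vocabulary,

* `KNSS2009_regularity_bound_C_over_r` — Theorem 6.1 (named fact);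
* `KNSS2009_regularity_typeI_rate` — Theorem 6.2 with both its assumptions (named fact; not on
  the critical path of `knss_no_axisymmetric_typeI`, recorded because the fact cites it);
* `hasSmoothExtensionPast_of_bounded` — the continuation principle "a classical Leray–Hopf
  solution bounded on `[0, T) × ℝ³` extends as a classical solution past `T`" (named fact;
  Robinson–Rodrigo–Sadowski 2016, Thm. 8.17 in the Serrin class `L²(0,T; L^∞)` with Thms. 6.15,
  6.10, 7.5; Leray 1934), in the rendering of the accepted
  `hasSmoothExtensionPast_of_eLpNorm_three_bounded` (`NSCriticalClosure.lean`);
* `axisymmetric_typeI_bounded` — the statement that alternative 1 forces boundedness on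
  `[0, T) × ℝ³`; a NAMED TARGET of the decomposition (tagged folklore: it is the standard
  "axisymmetric Leray–Hopf solutions admit no Type I singularity", printed locally as
  Seregin–Šverák Thm. 3.1; its proof from the catalogued local theorem and CKN is the next layer
  of this unit and is NOT claimed here);

and PROVES the assembly `knss_no_axisymmetric_typeI_of_parts : KNSS2009_regularity_bound_C_over_r →
hasSmoothExtensionPast_of_bounded → axisymmetric_typeI_bounded → knss_no_axisymmetric_typeI`, the
unconditional-in-`P1` half `hasSmoothExtensionPast_of_cylRadius_mul_norm_le` (alternative 2 from
Theorem 6.1 and the continuation fact alone), the corollary of Theorem 6.2 under its printed decay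
hypothesis (`hasSmoothExtensionPast_of_typeI_of_decay`), and the bookkeeping lemma
`IsTypeIBlowup.exists_sqrt_mul_norm_le` (the eventual rate of `IsTypeIBlowup` plus boundedness on
the sub-slabs give KNSS's (assumption1) on all of `[0, T)`).

## Rendering choices

* **Solution class.** KNSS state Theorems 6.1–6.2 for their bounded weak solutions
  (`IsBoundedWeakNSSolutionOn`, `KNSSLiouville.lean`) on every `ℝ³ × (0, T')`, `T' < T`. The facts
  below take a classical solution on the open time interval `(0, T)`
  (`IsClassicalNSSolutionOn (Ioo 0 T)`) bounded pointwise on each `(0, T') × ℝ³`: such a `u` is a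
  bounded weak solution on each sub-slab (pair the momentum equation with a compactly supported
  divergence-free space–time test field and integrate by parts; cf. the proved
  `IsClassicalNSSolutionOn.isWeakNSSolutionOn_holds`), so each fact is implied by its printed form.
  No energy hypothesis is imposed in Theorems 6.1–6.2 (KNSS impose none).
* **Symmetry and bounds** are pointwise for the (continuous) representative: every slice `u t`,
  `0 < t < T`, is `IsAxisymmetric`, and `cylRadius x * ‖u t x‖ ≤ C` (junk-free form of
  `|u| ≤ C/|x'|`, vacuous on the axis as in print), `√(T − t) ‖u t x‖ ≤ C`; stronger hypotheses
  than the a.e. ones of an `L^∞` class, hence harmless.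
* **Conclusion** "`|u| ≤ M = M(C)` in `ℝ³ × (0, T)`" is rendered `∃ M, ∀ t ∈ (0, T), ∀ x,
  ‖u t x‖ ≤ M`: the printed (essential) bound becomes an everywhere bound for a continuous
  representative on the open slab; the uniformity `M = M(C)` and the clause "`u` is a mild
  solution" are dropped (weaker conclusions).
* **Viscosity.** KNSS and RRS normalise `ν = 1`; the facts take `ν > 0`, reached by the scaling
  `v(s, x) = ν⁻¹ u(s/ν, x)` (proved for classical solutions as
  `IsClassicalNSSolutionOn.viscosityRescale_set`), which preserves axisymmetry and maps the
  hypotheses to `r‖v‖ ≤ C/ν`, `√(νT − s)‖v‖ ≤ C/√ν`.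

## What is NOT here

The proofs of the four named statements. Plan (unit notes): Theorem 6.1 from the zoom-in of
Prop. 6.1 (`KNSS2009_blowup_generates_ancient`) and the Liouville theorem 5.3
(`KNSS2009_liouville_bound_C_over_r`); the continuation fact from `ladyzhenskaya_prodi_serrin`
(with the strong-solution clause of RRS Thm. 8.17), `leray_local_strong_H1`, the proved weak–strong
uniqueness and `IsClassicalNSSolutionOn.glue`; `axisymmetric_typeI_bounded` from
`AxisymmetricTypeIExclusion`, `ckn_epsilon_regularity`, the dissipation form of CKN's Prop. 2, the
proved pressure normalisation `tao_pressure_normalisation_holds`, the space–time rescalings of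
`SpaceTimeRescaling.lean`, and a compactness argument on `{T} × closedBall 0 R`.

## References

* G. Koch, N. Nadirashvili, G. Seregin, V. Šverák, *Liouville theorems for the Navier–Stokes
  equations and applications*, Acta Math. 203 (2009) 83–105 = arXiv:0709.3599 (arXiv pages):
  §6, Lemma 6.1, Remark 6.1, Prop. 6.1, (6.1) (p. 11); Theorem 6.1 (= `typetwospace`) with its
  proof and Remark 6.2 (pp. 11–12); Theorem 6.2 (= `typetwotime`), (assumption1)–(assumption2)
  and its proof (pp. 12–13). [KochNadirashviliSereginSverak2009]
* G. Seregin, V. Šverák, Comm. PDE 34 (2009) 171–201 = arXiv:0804.1803, Thms. 1.1–1.2 (p. 3),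
  Thm. 3.1. [SereginSverak2009]
* J. C. Robinson, J. L. Rodrigo, W. Sadowski, *The Three-Dimensional Navier–Stokes Equations*,
  CUP 2016: Thm. 6.10 (PDF p. 106), Thm. 6.15 (p. 111), Thm. 7.5 (p. 118), Thm. 8.17 (p. 131),
  (11.18) (p. 163, Leray's rate). [RobinsonRodrigoSadowski2016]
* J. Leray, Acta Math. 63 (1934), §IV (the rate `‖u(t)‖_∞ ≥ ε₁ √ν (T − t)^{-1/2}` at an époque
  d'irrégularité, quoted as (6.1) by KNSS). [Leray1934]
* L. Caffarelli, R. Kohn, L. Nirenberg, Comm. Pure Appl. Math. 35 (1982), Props. 1–2.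
  [CaffarelliKohnNirenberg1982]
-/

noncomputable section

open MeasureTheory Set Function Filter Topology TopologicalSpace
open scoped NNReal ENNReal

namespace Literature.Analysis.FluidPDE

/-- Local notation for physical space `ℝ³ = EuclideanSpace ℝ (Fin 3)`. -/
local notation "ℝ³" => EuclideanSpace ℝ (Fin 3)

/-! ### KNSS 2009, Theorems 6.1 and 6.2 -/

/-- **KNSS 2009, Theorem 6.1** (Acta Math. 203 (2009) = arXiv:0709.3599, p. 11, label
`typetwospace`): "Let `u` be an axi-symmetric vector field in `ℝ³ × (0, T)` which belongs to
`L^∞(ℝ³ × (0, T'))` for each `T' < T`. Assume that `u` is a weak solution of the Navier–Stokes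
equations in `ℝ³ × (0, T)` and that `|u(x, t)| ≤ C/√(x₁² + x₂²)`. Then `|u| ≤ M = M(C)` in
`ℝ³ × (0, T)`. Moreover, `u` is a mild solution of the Navier–Stokes equations (for a suitable
initial datum)." Rendered (module docstring) for a classical solution `(u, p)` with viscosity
`ν > 0` on the open time interval `(0, T)`, bounded on every `(0, T') × ℝ³`, `T' < T` (such a `u`
is a bounded weak solution there in the sense of KNSS §4 (ii)), with axisymmetric slices and the
junk-free bound `cylRadius x * ‖u t x‖ ≤ C`; conclusion: `u` is bounded on `(0, T) × ℝ³` (the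
uniformity `M = M(C)` and mildness are dropped; `ν = 1` in print, `ν > 0` by the viscosity
scaling). Nothing is asserted; users take `(h : KNSS2009_regularity_bound_C_over_r)`.
[cite: KochNadirashviliSereginSverak2009, Thm 6.1 (§6, arXiv p. 11, label typetwospace)] -/
def KNSS2009_regularity_bound_C_over_r : Prop :=
  ∀ ⦃ν T : ℝ⦄ ⦃u : ℝ → ℝ³ → ℝ³⦄ ⦃p : ℝ → ℝ³ → ℝ⦄, 0 < ν → 0 < T →
    IsClassicalNSSolutionOn (Ioo 0 T) ν 0 u p →
    (∀ T' < T, ∃ M : ℝ, ∀ t ∈ Ioo 0 T', ∀ x, ‖u t x‖ ≤ M) →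
    (∀ t ∈ Ioo 0 T, IsAxisymmetric (u t)) →
    (∃ C : ℝ, ∀ t ∈ Ioo 0 T, ∀ x, cylRadius x * ‖u t x‖ ≤ C) →
    ∃ M : ℝ, ∀ t ∈ Ioo 0 T, ∀ x, ‖u t x‖ ≤ M

/-- **KNSS 2009, Theorem 6.2** (Acta Math. 203 (2009) = arXiv:0709.3599, p. 12, label
`typetwotime`): "Let `u` be an axi-symmetric vector field in `ℝ³ × (0, T)` which belongs to
`L^∞(ℝ³ × (0, T'))` for each `T' < T`. Assume that `u` is a weak solution of the Navier–Stokes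
equations in `ℝ³ × (0, T)` satisfying `|u(x, t)| ≤ C/√(T − t)` in `ℝ³ × (0, T)` (assumption1). In
addition, assume that there exists some `R₀ > 0` such that `|u(x, t)| ≤ C/|x'|` for `|x'| ≥ R₀`
(assumption2) […]. Then `|u| ≤ M = M(C)` in `ℝ³ × (0, T)`. Moreover, `u` is a mild solution".
KNSS add: "the statement fails, for trivial reasons, if we drop (assumption2). (Consider
`u(x,t) = b(t)`.)" Rendered exactly as Theorem 6.1 above (classical solution on `(0, T)` bounded
on the sub-slabs, pointwise axisymmetry, junk-free bounds `√(T − t) ‖u t x‖ ≤ C` and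
`cylRadius x * ‖u t x‖ ≤ C` for `cylRadius x ≥ R₀`, conclusion without `M = M(C)` and mildness,
`ν > 0` by scaling). Nothing is asserted; users take `(h : KNSS2009_regularity_typeI_rate)`.
[cite: KochNadirashviliSereginSverak2009, Thm 6.2 (§6, arXiv p. 12, label typetwotime, (assumption1)–(assumption2))] -/
def KNSS2009_regularity_typeI_rate : Prop :=
  ∀ ⦃ν T : ℝ⦄ ⦃u : ℝ → ℝ³ → ℝ³⦄ ⦃p : ℝ → ℝ³ → ℝ⦄, 0 < ν → 0 < T →
    IsClassicalNSSolutionOn (Ioo 0 T) ν 0 u p →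
    (∀ T' < T, ∃ M : ℝ, ∀ t ∈ Ioo 0 T', ∀ x, ‖u t x‖ ≤ M) →
    (∀ t ∈ Ioo 0 T, IsAxisymmetric (u t)) →
    (∃ C : ℝ, ∀ t ∈ Ioo 0 T, ∀ x, Real.sqrt (T - t) * ‖u t x‖ ≤ C) →
    (∃ C R₀ : ℝ, 0 < R₀ ∧ ∀ t ∈ Ioo 0 T, ∀ x, R₀ ≤ cylRadius x → cylRadius x * ‖u t x‖ ≤ C) →
    ∃ M : ℝ, ∀ t ∈ Ioo 0 T, ∀ x, ‖u t x‖ ≤ M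

/-! ### Continuation of bounded classical Leray–Hopf solutions -/

/-- **Continuation of bounded classical Leray–Hopf solutions** (Robinson–Rodrigo–Sadowski 2016,
Thm. 8.17 in the Serrin class `L²(0, T; L^∞)`, i.e. (8.10) with `r = 2`, `s = ∞`: a Leray–Hopf
weak solution in that class "is smooth on the time interval `(0, T]` and for every `ε > 0` is a
strong solution on `[ε, T]`", continued past `T` by the local strong solution from
`u(T) ∈ H¹(ℝ³)` (Thm. 6.15), identified by weak–strong uniqueness (Thm. 6.10) and smooth for
positive times (Thm. 7.5); equivalently the contrapositive of Leray's rate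
`‖u(t)‖_{L^∞} ≥ ε₁ (T − t)^{-1/2}` at a first singular time (Leray 1934; RRS (11.18) with `p = ∞`;
KNSS 2009, (6.1))). Rendering, as for the accepted `hasSmoothExtensionPast_of_eLpNorm_three_bounded`:
let `ν > 0`, `T > 0`, and let `(u, p)` be a classical solution of the unforced system on
`ℝ³ × [0, T)` which is Leray–Hopf on `[0, T)` from `u 0` and bounded on `[0, T) × ℝ³`
(so `u ∈ L²(0, T; L^∞)`); then `u` extends as a classical solution past `T`
(`HasSmoothExtensionPast ν 0 u T`: the extension keeps `u` on `[0, T)`, and its pressure may be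
renormalised by a function of time, cf. `IsClassicalNSSolutionOn.glue`). RRS normalise `ν = 1`;
`ν > 0` by the viscosity scaling. Nothing is asserted; users take
`(h : hasSmoothExtensionPast_of_bounded)`.
[cite: RobinsonRodrigoSadowski2016, Thm 8.17 (r = 2, s = ∞; PDF p. 131) with Thms 6.15, 6.10, 7.5] -/
def hasSmoothExtensionPast_of_bounded : Prop :=
  ∀ ⦃ν T : ℝ⦄ ⦃u : ℝ → ℝ³ → ℝ³⦄ ⦃p : ℝ → ℝ³ → ℝ⦄, 0 < ν → 0 < T →
    IsClassicalNSSolutionOn (Ico 0 T) ν 0 u p → IsLerayHopfOn T ν 0 (u 0) u →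
    (∃ M : ℝ, ∀ t ∈ Ico 0 T, ∀ x, ‖u t x‖ ≤ M) →
    HasSmoothExtensionPast ν 0 u T

/-! ### The Type I (rate) alternative: the target of the next layer -/

/-- **No axisymmetric Type I blow-up, boundedness form** — the standard global consequence of
Seregin–Šverák 2009, Thm. 3.1 (= Thm. 1.1: an axially symmetric distributional solution in the
unit cylinder with `v ∈ L³`, `q ∈ L^{3/2}` and `|v| ≤ C/√(−t)` is regular at the vertex; barrier
fact `Literature.Barriers.NavierStokesRegularity.AxisymmetricTypeIExclusion`) for finite-energy
classical solutions of the Cauchy problem: let `ν > 0`, `T > 0`, `(u, p)` classical on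
`ℝ³ × [0, T)`, Leray–Hopf on `[0, T)`, bounded on `[0, T'] × ℝ³` for every `T' < T`, with
axisymmetric slices, and blowing up at most at the Type I rate at `T` (`IsTypeIBlowup u T`); then
`u` is bounded on `[0, T) × ℝ³`. This is NOT a printed theorem and is not asserted: it is the
named target of the next layer of the decomposition of `knss_no_axisymmetric_typeI` (axis points by
the local theorem after translation and scaling, the hypotheses `u ∈ L³`, `p_R ∈ L^{3/2}` holding
for the Riesz pressure by the Type I rate and finite energy; off-axis points by CKN's dissipation
criterion and a rotation count against `∇u ∈ L²L²`; spatial infinity by ε-regularity on tails;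
then compactness of `{T} × closedBall 0 R`). KNSS's Theorem 6.2 does not give it (no pointwise
decay follows from finite energy). Users take `(h : axisymmetric_typeI_bounded)`. [folklore] -/
def axisymmetric_typeI_bounded : Prop :=
  ∀ ⦃ν T : ℝ⦄ ⦃u : ℝ → ℝ³ → ℝ³⦄ ⦃p : ℝ → ℝ³ → ℝ⦄, 0 < ν → 0 < T →
    IsClassicalNSSolutionOn (Ico 0 T) ν 0 u p → IsLerayHopfOn T ν 0 (u 0) u →
    (∀ T' < T, ∃ M : ℝ, ∀ t ∈ Icc 0 T', ∀ x, ‖u t x‖ ≤ M) →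
    (∀ t ∈ Ico 0 T, IsAxisymmetric (u t)) → IsTypeIBlowup u T →
    ∃ M : ℝ, ∀ t ∈ Ico 0 T, ∀ x, ‖u t x‖ ≤ M

/-! ### Bookkeeping: the Type I rate on the whole interval -/

section Bookkeeping

variable {E : Type*} [NormedAddCommGroup E]

/-- **From the eventual rate to (assumption1).** If `u` blows up at most at the Type I rate at `T`
(`‖u(t, x)‖ ≤ C/√(T − t)` for all `x` and all `t < T` close to `T`, `IsTypeIBlowup`) and is
bounded on `[0, T'] × E` for every `T' < T`, then `√(T − t) ‖u(t, x)‖ ≤ C'` for ALL `t ∈ [0, T)`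
and all `x` — the form of KNSS's (assumption1) (arXiv:0709.3599, Thm. 6.2) on the whole interval.
[cite: KochNadirashviliSereginSverak2009, Thm 6.2 (assumption1)] -/
theorem IsTypeIBlowup.exists_sqrt_mul_norm_le {u : ℝ → E → E} {T : ℝ} (hI : IsTypeIBlowup u T)
    (hbdd : ∀ T' < T, ∃ M : ℝ, ∀ t ∈ Icc 0 T', ∀ x, ‖u t x‖ ≤ M) :
    ∃ C : ℝ, ∀ t ∈ Ico 0 T, ∀ x, Real.sqrt (T - t) * ‖u t x‖ ≤ C := by
  obtain ⟨C, hC⟩ := hI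
  obtain ⟨T₁, hT₁T, hT₁⟩ := mem_nhdsLT_iff_exists_Ioo_subset.1 hC
  obtain ⟨M, hM⟩ := hbdd T₁ hT₁T
  refine ⟨max C (Real.sqrt T * max M 0), fun t ht x => ?_⟩
  by_cases htT₁ : T₁ < t
  · -- the rate regime
    have hrate : ‖u t x‖ ≤ C / Real.sqrt (T - t) := hT₁ ⟨htT₁, ht.2⟩ x
    have hpos : 0 < Real.sqrt (T - t) := Real.sqrt_pos.2 (sub_pos.2 ht.2)
    calc Real.sqrt (T - t) * ‖u t x‖ ≤ Real.sqrt (T - t) * (C / Real.sqrt (T - t)) :=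
          mul_le_mul_of_nonneg_left hrate hpos.le
      _ = C := mul_div_cancel₀ C hpos.ne'
      _ ≤ max C (Real.sqrt T * max M 0) := le_max_left _ _
  · -- the bounded regime `t ≤ T₁`
    have htI : t ∈ Icc 0 T₁ := ⟨ht.1, not_lt.1 htT₁⟩
    have h1 : Real.sqrt (T - t) ≤ Real.sqrt T := Real.sqrt_le_sqrt (by linarith [ht.1])
    have h2 : ‖u t x‖ ≤ max M 0 := (hM t htI x).trans (le_max_left _ _)
    calc Real.sqrt (T - t) * ‖u t x‖ ≤ Real.sqrt T * max M 0 :=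
          mul_le_mul h1 h2 (norm_nonneg _) (Real.sqrt_nonneg _)
      _ ≤ max C (Real.sqrt T * max M 0) := le_max_right _ _

end Bookkeeping

/-! ### Proved: the assembly of `knss_no_axisymmetric_typeI` from its parts -/

section Assembly

variable {ν T : ℝ} {u : ℝ → ℝ³ → ℝ³} {p : ℝ → ℝ³ → ℝ}

/-- Restriction of the sub-slab bounds from `[0, T']` to `(0, T')`. [folklore] -/
theorem forall_exists_bound_Ioo_of_Icc
    (hbdd : ∀ T' < T, ∃ M : ℝ, ∀ t ∈ Icc 0 T', ∀ x, ‖u t x‖ ≤ M) :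
    ∀ T' < T, ∃ M : ℝ, ∀ t ∈ Ioo 0 T', ∀ x, ‖u t x‖ ≤ M := fun T' hT' =>
  (hbdd T' hT').imp fun _ hM t ht x => hM t ⟨ht.1.le, ht.2.le⟩ x

/-- A bound on the open slab `(0, T) × ℝ³` and the sub-slab bounds (which cover `t = 0`) give a
bound on `[0, T) × ℝ³`. [folklore] -/
theorem exists_bound_Ico_of_Ioo (hT : 0 < T)
    (hbdd : ∀ T' < T, ∃ M : ℝ, ∀ t ∈ Icc 0 T', ∀ x, ‖u t x‖ ≤ M)
    (hM : ∃ M : ℝ, ∀ t ∈ Ioo 0 T, ∀ x, ‖u t x‖ ≤ M) :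
    ∃ M : ℝ, ∀ t ∈ Ico 0 T, ∀ x, ‖u t x‖ ≤ M := by
  obtain ⟨M, hM⟩ := hM
  obtain ⟨M₀, hM₀⟩ := hbdd 0 hT
  refine ⟨max M M₀, fun t ht x => ?_⟩
  rcases ht.1.eq_or_lt with h0 | h0
  · rw [← h0]
    exact (hM₀ 0 ⟨le_rfl, le_rfl⟩ x).trans (le_max_right _ _)
  · exact (hM t ⟨h0, ht.2⟩ x).trans (le_max_left _ _)

/-- **Alternative 2 of `knss_no_axisymmetric_typeI` from KNSS Theorem 6.1 and the continuation
principle.** A classical solution on `ℝ³ × [0, T)` (`ν > 0`, `T > 0`), Leray–Hopf on `[0, T)`,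
bounded on `[0, T'] × ℝ³` for every `T' < T`, axisymmetric, with `r ‖u‖ ≤ C` on `[0, T) × ℝ³`,
extends smoothly past `T`: Theorem 6.1 (applied on the open interval `(0, T)`, to which the
classical solution restricts, `IsClassicalNSSolutionOn.mono`) bounds `u` on `(0, T) × ℝ³`, the
sub-slab bound at `T' = 0` covers `t = 0`, and `hasSmoothExtensionPast_of_bounded` continues the
bounded solution (KNSS 2009, Thm. 6.1 with Remark 6.2). [cite: KochNadirashviliSereginSverak2009, Thm 6.1 and Remark 6.2 (arXiv p. 11)] -/
theorem hasSmoothExtensionPast_of_cylRadius_mul_norm_le (h61 : KNSS2009_regularity_bound_C_over_r)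
    (hB : hasSmoothExtensionPast_of_bounded) (hν : 0 < ν) (hT : 0 < T)
    (h : IsClassicalNSSolutionOn (Ico 0 T) ν 0 u p) (hLH : IsLerayHopfOn T ν 0 (u 0) u)
    (hbdd : ∀ T' < T, ∃ M : ℝ, ∀ t ∈ Icc 0 T', ∀ x, ‖u t x‖ ≤ M)
    (haxi : ∀ t ∈ Ico 0 T, IsAxisymmetric (u t))
    (hC : ∃ C : ℝ, ∀ t ∈ Ico 0 T, ∀ x, cylRadius x * ‖u t x‖ ≤ C) :
    HasSmoothExtensionPast ν 0 u T := by
  have h' : IsClassicalNSSolutionOn (Ioo 0 T) ν 0 u p :=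
    h.mono Ioo_subset_Ico_self isOpen_Ioo.uniqueDiffOn
  have haxi' : ∀ t ∈ Ioo 0 T, IsAxisymmetric (u t) := fun t ht => haxi t ⟨ht.1.le, ht.2⟩
  have hC' : ∃ C : ℝ, ∀ t ∈ Ioo 0 T, ∀ x, cylRadius x * ‖u t x‖ ≤ C :=
    hC.imp fun _ hC t ht x => hC t ⟨ht.1.le, ht.2⟩ x
  exact hB hν hT h hLH (exists_bound_Ico_of_Ioo hT hbdd
    (h61 hν hT h' (forall_exists_bound_Ioo_of_Icc hbdd) haxi' hC'))

/-- **Corollary of KNSS Theorem 6.2 under its printed decay hypothesis.** With the data of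
`knss_no_axisymmetric_typeI` (classical on `[0, T)`, Leray–Hopf, bounded on the sub-slabs,
axisymmetric), the Type I rate `IsTypeIBlowup u T` AND KNSS's (assumption2) `r ‖u‖ ≤ C` for
`r ≥ R₀` on `[0, T) × ℝ³` give a smooth extension past `T`: `IsTypeIBlowup.exists_sqrt_mul_norm_le`
supplies (assumption1) on all of `(0, T)`, Theorem 6.2 bounds `u`, and the continuation fact
concludes (KNSS 2009, Thm. 6.2). [cite: KochNadirashviliSereginSverak2009, Thm 6.2 (arXiv p. 12)] -/
theorem hasSmoothExtensionPast_of_typeI_of_decay (h62 : KNSS2009_regularity_typeI_rate)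
    (hB : hasSmoothExtensionPast_of_bounded) (hν : 0 < ν) (hT : 0 < T)
    (h : IsClassicalNSSolutionOn (Ico 0 T) ν 0 u p) (hLH : IsLerayHopfOn T ν 0 (u 0) u)
    (hbdd : ∀ T' < T, ∃ M : ℝ, ∀ t ∈ Icc 0 T', ∀ x, ‖u t x‖ ≤ M)
    (haxi : ∀ t ∈ Ico 0 T, IsAxisymmetric (u t)) (hI : IsTypeIBlowup u T)
    (hdecay : ∃ C R₀ : ℝ, 0 < R₀ ∧ ∀ t ∈ Ico 0 T, ∀ x, R₀ ≤ cylRadius x → cylRadius x * ‖u t x‖ ≤ C) :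
    HasSmoothExtensionPast ν 0 u T := by
  have h' : IsClassicalNSSolutionOn (Ioo 0 T) ν 0 u p :=
    h.mono Ioo_subset_Ico_self isOpen_Ioo.uniqueDiffOn
  have haxi' : ∀ t ∈ Ioo 0 T, IsAxisymmetric (u t) := fun t ht => haxi t ⟨ht.1.le, ht.2⟩
  have hrate : ∃ C : ℝ, ∀ t ∈ Ioo 0 T, ∀ x, Real.sqrt (T - t) * ‖u t x‖ ≤ C :=
    (hI.exists_sqrt_mul_norm_le hbdd).imp fun _ hC t ht x => hC t ⟨ht.1.le, ht.2⟩ x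
  have hdecay' : ∃ C R₀ : ℝ, 0 < R₀ ∧
      ∀ t ∈ Ioo 0 T, ∀ x, R₀ ≤ cylRadius x → cylRadius x * ‖u t x‖ ≤ C := by
    obtain ⟨C, R₀, hR₀, hC⟩ := hdecay
    exact ⟨C, R₀, hR₀, fun t ht x hx => hC t ⟨ht.1.le, ht.2⟩ x hx⟩
  exact hB hν hT h hLH (exists_bound_Ico_of_Ioo hT hbdd
    (h62 hν hT h' (forall_exists_bound_Ioo_of_Icc hbdd) haxi' hrate hdecay'))

/-- **Assembly: `knss_no_axisymmetric_typeI` from its parts.** The accepted fact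
`knss_no_axisymmetric_typeI` (Axisymmetric.lean) follows from KNSS 2009, Theorem 6.1
(`KNSS2009_regularity_bound_C_over_r`), the continuation of bounded classical Leray–Hopf
solutions (`hasSmoothExtensionPast_of_bounded`), and the boundedness form of the exclusion of
axisymmetric Type I blow-up (`axisymmetric_typeI_bounded`, the target of the next layer): the
second alternative is `hasSmoothExtensionPast_of_cylRadius_mul_norm_le`, the first is the target
followed by the continuation fact. [cite: KochNadirashviliSereginSverak2009, Thms 6.1–6.2 (§6, arXiv pp. 11–13)] -/
theorem knss_no_axisymmetric_typeI_of_parts (h61 : KNSS2009_regularity_bound_C_over_r)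
    (hB : hasSmoothExtensionPast_of_bounded) (hP : axisymmetric_typeI_bounded) :
    knss_no_axisymmetric_typeI := by
  intro ν T hν hT u p h hLH hbdd haxi htypeI
  rcases htypeI with hI | hC
  · exact hB hν hT h hLH (hP hν hT h hLH hbdd haxi hI)
  · exact hasSmoothExtensionPast_of_cylRadius_mul_norm_le h61 hB hν hT h hLH hbdd haxi hC

end Assembly

end Literature.Analysis.FluidPDE

end
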